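import Literature.Probability.RandomPlanarGeometry.SLEFourRemovability
import Literature.Probability.RandomPlanarGeometry.CritPercSLEDimensionUpperBound
import Literature.Probability.RandomPlanarGeometry.RohdeSchrammCor35Proofs
import HarnessLib

/-!
# Conformal removability of SLE₄ (Kavvadias–Miller–Schoug 2022, Thm 1.1) — proofs, part 1:
# the a.s. thickening (upper Minkowski) bound for the SLE_κ trace on compacts of `ℍ`

Proof file for the named fact `KavvadiasMillerSchoug2022_thm11` (`SLEFourRemovability.lean`;
K. Kavvadias, J. Miller, L. Schoug, *Conformal removability of SLE₄*, arXiv:2209.10532). The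
printed proof of Theorem 1.1 (p. 61) verifies the hypotheses of the removability Theorem 8.1
(p. 62) for `X = η[0, ∞)`; its last line is the dimension input

> "The proof is then complete by using that `dim_M(K ∩ η) ≤ dim_M(η) = 3/2` a.s. [47, 5], where
> for a set `A`, `dim_M(A)` denotes the upper Minkowski dimension of `A`." (p. 61)

(`[47]` = Rohde–Schramm, *Basic properties of SLE*, Ann. of Math. 161 (2005), Thm. 8.1;
`[5]` = Beffara, Ann. Probab. 36 (2008)), consumed in the proof of Theorem 8.1, Step 2a (p. 68)
in the quantitative form

> "Since the upper Minkowski dimension of `K` is at most `2 - 5a` … there exists a finite constant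
> `c₁` such that `L²({z ∈ ℂ : dist(z, K) ≤ r}) ≤ c₁ r^{4a}` for all `r ∈ (0, 1)`."

This file PROVES that input for the chordal SLE_κ trace, `0 < κ < 8` (then `κ = 4`), from the
tree's one-point estimate (`exists_onePoint_upper_of_isCompact`, Rohde–Schramm Lemma 6.3 /
Thm. 8.1, proved in `CritPercSLEDimensionUpperBound.lean`) by the first-moment dyadic covering
argument of `CritPercSLEDimensionUpper.lean` (hit counts of the dyadic grid of a square, Markov,
Borel–Cantelli), with the covering of the THICKENING of the trace by enlarged hit balls in place
of the Hausdorff-measure bound: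

* `cthickening_inter_range_subset_iUnion_hit` — the `εₖ`-neighbourhood of `Q ∩ γ[0, ∞)` is covered
  by the balls of radius `3εₖ` about the hit grid points (`εₖ = 2L/2^k`);
* `ae_volume_cthickening_inter_range_le` — in a closed square `Q ⊆ ℍ` of side `L` where the
  one-point estimate holds with exponent `s`: for `b < s`, `b < 2`, almost surely, for all large
  `k`, `area(N_{εₖ}(Q ∩ γ[0, ∞))) ≤ 36 π L² (2^k)^{-b}`;
* `ae_forall_isCompact_volume_cthickening_le` — for `0 < κ < 8`, `HasSLETrace κ` and every
  `b < 1 - κ/8`: almost surely, for EVERY compact `K ⊆ ℍ` there is `C` with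
  `area(N_{2^{-k}}(K ∩ γ[0, ∞))) ≤ C (2^k)^{-b}` for all large `k` (one null set for all `K`:
  the countable exhaustion of `ℍ` by the squares `hpSquareCorner`);
* `ae_forall_isCompact_volume_cthickening_sleTrace_four_le` — the case `κ = 4` (Rohde–Schramm
  Thm. 5.1 `hasSLETrace_of_ne_eight_holds`): every exponent `b < 1/2`, i.e. `dim_M ≤ 3/2` in the
  form `4a = b`, `a < 1/8`, used on p. 68.

No named fact is introduced (D-0026); the remaining parts of the printed proof (Thm. 8.1,
Lemma 8.2, Prop. 7.2 and the GFF level-line theory behind it) are recorded in the unit's notes.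

## References

* [KavvadiasMillerSchoug2022] K. Kavvadias, J. Miller, L. Schoug, *Conformal removability of
  SLE₄*, arXiv:2209.10532, proof of Thm. 1.1 (p. 61) and proof of Thm. 8.1, Step 2a (p. 68).
* [RohdeSchramm2005] S. Rohde, O. Schramm, *Basic properties of SLE*, Ann. of Math. 161 (2005),
  Thm. 8.1 (the covering argument from the one-point estimate, Lemma 6.3).
* [Beffara2008] V. Beffara, *The dimension of the SLE curves*, Ann. Probab. 36 (2008), Prop. 1 (1).
-/

noncomputable section

open Set Filter Topology MeasureTheory ProbabilityTheory Metric Complex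
open UpperHalfPlane (upperHalfPlaneSet isOpen_upperHalfPlaneSet)
open scoped NNReal ENNReal

namespace Literature.Probability.RandomPlanarGeometry

open Literature.Probability.Process

variable {κ : ℝ≥0}

/-! ### Covering the thickening of the trace in a square by enlarged hit balls -/

/-- The `εₖ`-neighbourhood of the part of the trace in the square is covered by the balls of
radius `3εₖ` about the hit grid points, `εₖ = 2L/2^k` (a point within `εₖ` of the trace is within
`2εₖ` of a point of `Q ∩ γ[0, ∞)`, which is within `εₖ` of a hit grid point,
`inter_range_subset_iUnion_hit`). [folklore] -/
theorem cthickening_inter_range_subset_iUnion_hit {a : ℂ} {L : ℝ} (hL : 0 < L) (k : ℕ)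
    (ω : ℝ≥0 → ℝ) :
    cthickening (2 * L / 2 ^ k) (closedSquare a L ∩ range (sleTrace κ ω)) ⊆
      ⋃ p : ↥(hitFinset κ a L k ω), ball (gridPt a L k p.1) (3 * (2 * L / 2 ^ k)) := by
  intro w hw
  set ε : ℝ := 2 * L / 2 ^ k with hε
  have hεpos : 0 < ε := by rw [hε]; positivity
  rw [mem_cthickening_iff] at hw
  have hlt : infEDist w (closedSquare a L ∩ range (sleTrace κ ω)) < ENNReal.ofReal (2 * ε) :=
    hw.trans_lt ((ENNReal.ofReal_lt_ofReal_iff (by positivity)).2 (by linarith))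
  obtain ⟨x, hx, hwx⟩ := infEDist_lt_iff.1 hlt
  have hdist : dist w x < 2 * ε := by
    rw [edist_dist] at hwx
    exact (ENNReal.ofReal_lt_ofReal_iff (by positivity)).1 hwx
  obtain ⟨p, hp⟩ := mem_iUnion.1 (inter_range_subset_iUnion_hit (κ := κ) hL k ω hx)
  refine mem_iUnion.2 ⟨p, ?_⟩
  rw [mem_ball] at hp ⊢
  calc dist w (gridPt a L k p.1) ≤ dist w x + dist x (gridPt a L k p.1) := dist_triangle _ _ _
    _ < 2 * ε + ε := add_lt_add hdist hp
    _ = 3 * ε := by ring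

/-! ### The first-moment argument for the thickening in one square -/

/-- **The a.s. thickening bound in one square.** If every point of the closed square `Q` of side
`L` is hit by the `ε`-neighbourhood of the trace with probability `≤ c₂ ε^s` for `0 < ε ≤ ε₀`, then
for every `b < s`, `b < 2`, almost surely, for all large `k`,
`area(N_{εₖ}(Q ∩ γ[0, ∞))) ≤ 36 π L² (2^k)^{-b}` (`εₖ = 2L/2^k`): the dyadic hit count `Nₖ`
satisfies `E Nₖ ≤ 4 c₂ (2L)^s (2^k)^{2-s}` (`lintegral_hitCount_le`, `count_bound`), so by Markov
and Borel–Cantelli a.s. `Nₖ < (2^k)^{2-b}` eventually, and the neighbourhood is covered by `Nₖ`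
balls of radius `3εₖ` (`cthickening_inter_range_subset_iUnion_hit`). This is the box-counting
(upper Minkowski) form of Rohde–Schramm's Thm. 8.1 / Beffara's Prop. 1 (1).
[cite: RohdeSchramm2005, Thm 8.1 (proof)] -/
theorem ae_volume_cthickening_inter_range_le (hκ : HasSLETrace κ) {a : ℂ} {L : ℝ} (hL : 0 < L)
    {s : ℝ} {c₂ : ℝ≥0∞} (hc₂ : c₂ ≠ ⊤) {ε₀ : ℝ} (hε₀ : 0 < ε₀)
    (hA : ∀ ε : ℝ, 0 < ε → ε ≤ ε₀ → ∀ z ∈ closedSquare a L,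
      preWienerMeasure {ω | infDist z (range (sleTrace κ ω)) ≤ ε} ≤ c₂ * ENNReal.ofReal (ε ^ s))
    {b : ℝ} (hbs : b < s) (hb2 : b < 2) :
    ∀ᵐ ω ∂preWienerMeasure, ∀ᶠ k in atTop,
      volume (cthickening (2 * L / 2 ^ k) (closedSquare a L ∩ range (sleTrace κ ω))) ≤
        ENNReal.ofReal (36 * Real.pi * L ^ 2 * ((2 : ℝ) ^ k) ^ (-b)) := by
  haveI := isProbabilityMeasure_preWienerMeasure'
  -- the scales `εₖ = 2L/2^k`, eventually `≤ ε₀`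
  set ε : ℕ → ℝ := fun k ↦ 2 * L / 2 ^ k with hε
  have hεpos : ∀ k, 0 < ε k := fun k ↦ by rw [hε]; positivity
  have hεlim : Tendsto ε atTop (𝓝 0) := by
    have h := (tendsto_inv_atTop_zero.comp (tendsto_pow_atTop_atTop_of_one_lt one_lt_two)).const_mul
      (2 * L)
    rw [mul_zero] at h
    refine h.congr fun k ↦ ?_
    simp [hε, div_eq_mul_inv]
  obtain ⟨k₀, hk₀⟩ : ∃ k₀, ∀ k ≥ k₀, ε k ≤ ε₀ :=
    eventually_atTop.1 (hεlim.eventually (Iic_mem_nhds hε₀))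
  -- hit probabilities at the levels `k ≥ k₀`
  have hhit : ∀ k ≥ k₀, ∀ ij ∈ gridIndex k,
      preWienerMeasure (hitEvent κ (gridPt a L k ij) (2 * L / 2 ^ k)) ≤
        c₂ * ENNReal.ofReal ((2 * L / 2 ^ k) ^ s) := by
    intro k hk ij hij
    rw [hitEvent_eq κ _ (hεpos k).le]
    exact hA (ε k) (hεpos k) (hk₀ k hk) _ (gridPt_mem_closedSquare hL hij)
  -- the level `α = 2 - b > 2 - s`, `α > 0`
  set α : ℝ := 2 - b with hαdef
  have hαs : 2 - s < α := by rw [hαdef]; linarith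
  have hα0 : 0 < α := by rw [hαdef]; linarith
  set τ : ℝ := (2 : ℝ) ^ α with hτ
  have hτ1 : 1 < τ := Real.one_lt_rpow (by norm_num) hα0
  have hτ0 : 0 < τ := zero_lt_one.trans hτ1
  set ρ : ℝ := (2 : ℝ) ^ (2 - s - α) with hρ
  have hρ1 : ρ < 1 := Real.rpow_lt_one_of_one_lt_of_neg (by norm_num) (by linarith)
  -- the bad events `Aₖ = {Nₖ ≥ τ^k}` and their probabilities
  set A : ℕ → Set (ℝ≥0 → ℝ) := fun k ↦ {ω | ENNReal.ofReal (τ ^ k) ≤ hitCount κ a L k ω}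
    with hA'
  have hPA : ∀ k ≥ k₀, preWienerMeasure (A k) ≤
      c₂ * ENNReal.ofReal (4 * (2 * L) ^ s) * ENNReal.ofReal ρ ^ k := by
    intro k hk
    have hτk : 0 < τ ^ k := pow_pos hτ0 k
    calc preWienerMeasure (A k)
        ≤ (∫⁻ ω, hitCount κ a L k ω ∂preWienerMeasure) / ENNReal.ofReal (τ ^ k) :=
          meas_ge_le_lintegral_div (aemeasurable_hitCount hκ a L k)
            (ENNReal.ofReal_pos.2 hτk).ne' ENNReal.ofReal_ne_top
      _ ≤ c₂ * ENNReal.ofReal ((((2 : ℝ) ^ k + 1) ^ 2) * (2 * L / 2 ^ k) ^ s) /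
            ENNReal.ofReal (τ ^ k) := by
          gcongr
          exact lintegral_hitCount_le hκ (hhit k hk)
      _ = c₂ * ENNReal.ofReal ((((2 : ℝ) ^ k + 1) ^ 2) * (2 * L / 2 ^ k) ^ s /
            ((2 : ℝ) ^ k) ^ α) := by
          rw [mul_div_assoc, ← ENNReal.ofReal_div_of_pos hτk, hτ, ← two_pow_rpow_comm]
      _ ≤ c₂ * ENNReal.ofReal (4 * (2 * L) ^ s * ((2 : ℝ) ^ k) ^ (2 - s - α)) := by
          gcongr
          exact count_bound (by linarith) s α k
      _ = c₂ * ENNReal.ofReal (4 * (2 * L) ^ s) * ENNReal.ofReal ρ ^ k := by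
          rw [two_pow_rpow_comm, ← hρ, ENNReal.ofReal_mul (by positivity), ENNReal.ofReal_pow
            (by positivity), mul_assoc]
  -- summability and Borel–Cantelli along `k + k₀`
  have hsum : ∑' k, preWienerMeasure (A (k + k₀)) ≠ ⊤ := by
    have hle : ∀ k, preWienerMeasure (A (k + k₀)) ≤
        c₂ * ENNReal.ofReal (4 * (2 * L) ^ s) * ENNReal.ofReal ρ ^ (k + k₀) :=
      fun k ↦ hPA (k + k₀) (Nat.le_add_left k₀ k)
    refine ne_top_of_le_ne_top ?_ (ENNReal.tsum_le_tsum hle)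
    rw [ENNReal.tsum_mul_left]
    refine ENNReal.mul_ne_top (ENNReal.mul_ne_top hc₂ ENNReal.ofReal_ne_top) ?_
    simp_rw [pow_add]
    rw [ENNReal.tsum_mul_right, ENNReal.tsum_geometric]
    refine ENNReal.mul_ne_top (ENNReal.inv_ne_top.2 ?_) (ENNReal.pow_ne_top ENNReal.ofReal_ne_top)
    exact (tsub_pos_of_lt (ENNReal.ofReal_lt_one.2 hρ1)).ne'
  have hBC : preWienerMeasure (limsup (fun k ↦ A (k + k₀)) atTop) = 0 :=
    measure_limsup_atTop_eq_zero hsum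
  have hae : ∀ᵐ ω ∂preWienerMeasure, ∀ᶠ k in atTop,
      hitCount κ a L (k + k₀) ω < ENNReal.ofReal (τ ^ (k + k₀)) := by
    have h0 : ∀ᵐ ω ∂preWienerMeasure, ω ∉ limsup (fun k ↦ A (k + k₀)) atTop :=
      measure_eq_zero_iff_ae_notMem.1 hBC
    filter_upwards [h0] with ω hω
    rw [mem_limsup_iff_frequently_mem, Filter.not_frequently] at hω
    filter_upwards [hω] with k hk
    simpa only [hA', mem_setOf_eq, not_le] using hk
  filter_upwards [hae] with ω hω
  -- from `k + k₀` to all large `k`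
  have hω' : ∀ᶠ k in atTop, hitCount κ a L k ω < ENNReal.ofReal (τ ^ k) := by
    rw [eventually_atTop] at hω ⊢
    obtain ⟨N, hN⟩ := hω
    refine ⟨N + k₀, fun k hk ↦ ?_⟩
    have h := hN (k - k₀) (by omega)
    rwa [Nat.sub_add_cancel (by omega)] at h
  filter_upwards [hω'] with k hk
  -- the covering estimate
  have h2k : (0 : ℝ) < 2 ^ k := by positivity
  have key : τ ^ k * ((3 * ε k) ^ 2 * Real.pi) = 36 * Real.pi * L ^ 2 * ((2 : ℝ) ^ k) ^ (-b) := by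
    have hb' : -b = α - 2 := by rw [hαdef]; ring
    rw [hb', Real.rpow_sub h2k, Real.rpow_two, hτ, ← two_pow_rpow_comm]
    simp only [hε]
    field_simp
    ring
  calc volume (cthickening (ε k) (closedSquare a L ∩ range (sleTrace κ ω)))
      ≤ volume (⋃ p : ↥(hitFinset κ a L k ω), ball (gridPt a L k p.1) (3 * ε k)) :=
        measure_mono (cthickening_inter_range_subset_iUnion_hit hL k ω)
    _ ≤ ∑ p : ↥(hitFinset κ a L k ω), volume (ball (gridPt a L k p.1) (3 * ε k)) :=
        measure_iUnion_fintype_le _ _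
    _ = (hitFinset κ a L k ω).card * (ENNReal.ofReal (3 * ε k) ^ 2 * NNReal.pi) := by
        simp only [Complex.volume_ball, Finset.sum_const, Finset.card_univ, Fintype.card_coe,
          nsmul_eq_mul]
    _ ≤ ENNReal.ofReal (τ ^ k) * (ENNReal.ofReal (3 * ε k) ^ 2 * NNReal.pi) := by
        gcongr
        rw [← hitCount_eq_card]
        exact hk.le
    _ = ENNReal.ofReal (τ ^ k * ((3 * ε k) ^ 2 * Real.pi)) := by
        rw [ENNReal.ofReal_mul (pow_pos hτ0 k).le, ENNReal.ofReal_mul (sq_nonneg _),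
          ENNReal.ofReal_pow (by positivity : (0 : ℝ) ≤ 3 * ε k), ← NNReal.coe_real_pi,
          ENNReal.ofReal_coe_nnreal]
    _ = ENNReal.ofReal (36 * Real.pi * L ^ 2 * ((2 : ℝ) ^ k) ^ (-b)) := by rw [key]

/-! ### Exhaustion of `ℍ` by squares and the bound on every compact set at once -/

/-- A point `z ∈ ℍ` lies in the square `Qₙ = [-(n+1), n+1] × [1/(n+1), 1/(n+1) + 2(n+1)]` as
soon as `n ≥ max(|re z|, im z, 1/im z)` (the choice made in `exists_mem_hpSquare`). [folklore] -/
theorem mem_hpSquare_of_le {z : ℂ} (hz : 0 < z.im) {n : ℕ}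
    (hn : max |z.re| (max z.im (1 / z.im)) ≤ n) :
    z ∈ closedSquare (hpSquareCorner n) (2 * ((n : ℝ) + 1)) := by
  have h1 : |z.re| ≤ n := (le_max_left _ _).trans hn
  have h2 : z.im ≤ n := ((le_max_left _ _).trans (le_max_right _ _)).trans hn
  have h3 : 1 / z.im ≤ n := ((le_max_right _ _).trans (le_max_right _ _)).trans hn
  have hn0 : (0 : ℝ) < (n : ℝ) + 1 := by positivity
  rw [abs_le] at h1
  simp only [closedSquare, mem_setOf_eq, hpSquareCorner_re, hpSquareCorner_im]
  refine ⟨by linarith, by linarith, ?_, ?_⟩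
  · rw [div_le_iff₀ hn0]
    have : 1 ≤ z.im * n := by
      rw [div_le_iff₀ hz] at h3
      linarith
    nlinarith
  · have : 0 ≤ 1 / ((n : ℝ) + 1) := by positivity
    linarith

/-- Every compact subset of the open upper half-plane lies in one of the squares `Qₙ`
(it is bounded and its imaginary parts are bounded below by a positive constant). [folklore] -/
theorem exists_subset_hpSquare_of_isCompact {K : Set ℂ} (hK : IsCompact K)
    (hKH : K ⊆ upperHalfPlaneSet) :
    ∃ n : ℕ, K ⊆ closedSquare (hpSquareCorner n) (2 * ((n : ℝ) + 1)) := by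
  rcases K.eq_empty_or_nonempty with rfl | hne
  · exact ⟨0, empty_subset _⟩
  obtain ⟨z₀, hz₀K, hz₀⟩ := hK.exists_isMinOn hne Complex.continuous_im.continuousOn
  have hm0 : 0 < z₀.im := hKH hz₀K
  obtain ⟨R, hR⟩ := hK.isBounded.subset_closedBall (0 : ℂ)
  obtain ⟨n, hn⟩ := exists_nat_ge (max R (1 / z₀.im))
  refine ⟨n, fun z hz ↦ mem_hpSquare_of_le (hKH hz) ?_⟩
  have hzR : ‖z‖ ≤ R := by simpa using hR hz
  have h1 : |z.re| ≤ R := (abs_re_le_norm z).trans hzR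
  have h2 : z.im ≤ R := (le_abs_self _).trans ((abs_im_le_norm z).trans hzR)
  have h3 : 1 / z.im ≤ 1 / z₀.im := div_le_div_of_nonneg_left zero_le_one hm0 (hz₀ hz)
  exact max_le (h1.trans ((le_max_left _ _).trans hn))
    (max_le (h2.trans ((le_max_left _ _).trans hn)) (h3.trans ((le_max_right _ _).trans hn)))

/-- **The a.s. upper Minkowski (thickening) bound for the SLE_κ trace, `0 < κ < 8`.** If SLE_κ is
generated by a curve (`HasSLETrace κ`), then for every `b < 1 - κ/8`, almost surely, for EVERY
compact `K ⊆ ℍ` there is a constant `C` with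
`area({z : dist(z, K ∩ γ[0, ∞)) ≤ 2^{-k}}) ≤ C (2^k)^{-b}` for all large `k` — i.e.
`dim_M(K ∩ γ[0, ∞)) ≤ 2 - b` quantitatively, the input "`dim_M(K ∩ η) ≤ dim_M(η) = 3/2` a.s.
[47, 5]" of the proof of Kavvadias–Miller–Schoug's Thm. 1.1 (p. 61) in the form used in the
proof of their Thm. 8.1, Step 2a (p. 68). Proof: the one-point estimate with an exponent
`s ∈ (b, 1 - κ/8)` on each square `Qₙ` of the countable exhaustion of `ℍ`
(`exists_onePoint_upper_of_isCompact`, Rohde–Schramm Lemma 6.3), the square bound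
`ae_volume_cthickening_inter_range_le` for all `n` at once, and `K ⊆ Qₙ` for some `n`
(`exists_subset_hpSquare_of_isCompact`; `2^{-k} ≤ εₖ = 4(n+1)/2^k`).
[cite: RohdeSchramm2005, Thm 8.1] [cite: KavvadiasMillerSchoug2022, proof of Thm 1.1 (p. 61)] -/
theorem ae_forall_isCompact_volume_cthickening_le (hκ0 : 0 < κ) (hκ8 : κ < 8)
    (hT : HasSLETrace κ) {b : ℝ} (hb : b < 1 - (κ : ℝ) / 8) :
    ∀ᵐ ω ∂preWienerMeasure, ∀ K : Set ℂ, IsCompact K → K ⊆ upperHalfPlaneSet →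
      ∃ C : ℝ, ∀ᶠ k in atTop,
        volume (cthickening ((2 : ℝ) ^ k)⁻¹ (K ∩ range (sleTrace κ ω))) ≤
          ENNReal.ofReal (C * ((2 : ℝ) ^ k) ^ (-b)) := by
  have hκ8' : (κ : ℝ) < 8 := by exact_mod_cast hκ8
  have hpos : (0 : ℝ) < 1 - (κ : ℝ) / 8 := by linarith
  obtain ⟨s, hs, hs8⟩ := exists_between (max_lt hb hpos)
  have hbs : b < s := (le_max_left _ _).trans_lt hs
  have hs0 : 0 < s := (le_max_right _ _).trans_lt hs
  have hb2 : b < 2 := by linarith [κ.coe_nonneg]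
  -- the bound in every square `Qₙ`, almost surely for all `n` at once
  have hsq : ∀ n : ℕ, ∀ᵐ ω ∂preWienerMeasure, ∀ᶠ k in atTop,
      volume (cthickening (2 * (2 * ((n : ℝ) + 1)) / 2 ^ k)
        (closedSquare (hpSquareCorner n) (2 * ((n : ℝ) + 1)) ∩ range (sleTrace κ ω))) ≤
        ENNReal.ofReal (36 * Real.pi * (2 * ((n : ℝ) + 1)) ^ 2 * ((2 : ℝ) ^ k) ^ (-b)) := by
    intro n
    have hL : 0 < 2 * ((n : ℝ) + 1) := by positivity
    have him : 0 < (hpSquareCorner n).im := by rw [hpSquareCorner_im]; positivity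
    obtain ⟨c₂, hc₂, ε₀, hε₀, h⟩ := exists_onePoint_upper_of_isCompact hκ0 hs0 hs8 hT _
      (isCompact_closedSquare _ _) (closedSquare_subset_upperHalfPlaneSet him _)
    exact ae_volume_cthickening_inter_range_le hT hL hc₂ hε₀ h hbs hb2
  rw [← ae_all_iff] at hsq
  filter_upwards [hsq] with ω hω K hK hKH
  obtain ⟨n, hn⟩ := exists_subset_hpSquare_of_isCompact hK hKH
  refine ⟨36 * Real.pi * (2 * ((n : ℝ) + 1)) ^ 2, ?_⟩
  filter_upwards [hω n] with k hk
  refine le_trans (measure_mono ?_) hk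
  refine (cthickening_mono ?_ _).trans
    (cthickening_subset_of_subset _ (inter_subset_inter_left _ hn))
  rw [inv_eq_one_div]
  exact div_le_div_of_nonneg_right (by nlinarith [(Nat.cast_nonneg n : (0 : ℝ) ≤ n)])
    (by positivity)

/-- **The dimension input of Kavvadias–Miller–Schoug's Theorem 1.1, `κ = 4`**: for the SLE₄ trace
(generated by a curve a.s., Rohde–Schramm Thm. 5.1, `hasSLETrace_of_ne_eight_holds`) and every
`b < 1/2`, almost surely, for every compact `K ⊆ ℍ` there is `C` with
`area({z : dist(z, K ∩ η[0, ∞)) ≤ 2^{-k}}) ≤ C (2^k)^{-b}` for all large `k` ("`dim_M(K ∩ η) ≤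
dim_M(η) = 3/2` a.s.", p. 61; with `b = 4a`, `a < 1/8`, this is the constant `c₁` of p. 68).
[cite: KavvadiasMillerSchoug2022, proof of Thm 1.1 (p. 61)] -/
theorem ae_forall_isCompact_volume_cthickening_sleTrace_four_le {b : ℝ} (hb : b < 1 / 2) :
    ∀ᵐ ω ∂preWienerMeasure, ∀ K : Set ℂ, IsCompact K → K ⊆ upperHalfPlaneSet →
      ∃ C : ℝ, ∀ᶠ k in atTop,
        volume (cthickening ((2 : ℝ) ^ k)⁻¹ (K ∩ range (sleTrace 4 ω))) ≤
          ENNReal.ofReal (C * ((2 : ℝ) ^ k) ^ (-b)) := by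
  have h4 : (4 : ℝ≥0) ≠ 8 := by norm_num
  refine ae_forall_isCompact_volume_cthickening_le (by norm_num) (by norm_num)
    (hasSLETrace_of_ne_eight_holds h4) ?_
  push_cast
  linarith

end Literature.Probability.RandomPlanarGeometry

end
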